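import Mathlib
import HarnessLib
import Summits.NavierStokesRegularity.NavierStokesRegularity.Theorems.TaylorModelRungThreeCertificateIntervalDEnclose

/-!
# Crux K1b-DR (stmt-NavierStokesRegularity-23954), line `taylor-model` — certificate SOUNDNESS tooling: INTERVAL JETS, part 1 —
# the interval extension of the Taylor-jet recursion of a quadratic field is an enclosure (S1-VECTOR-23954 §1/§3 (B); dss_58 (A)/(B))

The vector step of the v3 checker needs, per sub-step, a COMPONENTWISE enclosure `|T y (p+1) c| ≤ J c` of the order-`p+1`
Taylor jet over the a-priori box (hypothesis `hJ` of `TaylorModelVector.abs_sub_taylor_le_of_mem_Icc`, p613013 lineage) — "what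
an interval evaluation of the recursion certifies". This file proves exactly that, ABSTRACTLY: for any type `V` of states read
through coordinate functionals `rd : V → σ → ℝ`, any field `Q : V → V → V` and jet maps `T : V → ℕ → V` obeying the Cauchy-product
recursion coordinatewise (`rd (T x 0) = rd x`, `(k+1)·rd (T x (k+1)) c = Σ_{i≤k} rd (Q (T x i) (T x (k-i))) c` — the literal
`T_zero/T_succ` of S1 at `V = ι → ℝ`, `rd = eval`; `taylorJet_succ` for window functions), and any INTERVAL EXTENSION `QB` of the
field (`IsFieldEnclosure`: boxes in, a box out containing the coordinate), every family of boxes `J k c` whose level `k+1`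
contains the rounded interval evaluation `jetStep QB prec J k c = (Σ_{m≤k} QB (J m) (J (k-m)) c) / (k+1)` of the recursion
(`IsJetEnclosure`, a containment — so ANY implementation, memoised / array-coded / re-rounded, qualifies) encloses the jets
of every point of the initial box: `rd (T y k) c ∈ J k c` (`mem_jet_of_isJetEnclosure`), hence `|rd (T y (p+1)) c| ≤ mag (J (p+1) c)`
on a box `[lo, hi] ⊆ J 0` (`abs_jet_le_mag_of_mem_Icc`, the `hJ` supplier). The variational twin (`varJetStep`, `IsVarJetEnclosure`,
`mem_varJet_of_isVarJetEnclosure`) does the same for S1's `U x v k` along the state levels. Tooling: rounded range sums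
`rangeSumR` with `mem_rangeSumR`, convexity `mem_of_le_of_le`. Part 2 (`…IntervalDJetsArray`) materialises the levels as arrays.

MODEL-lattice bookkeeping only (rung TL-M3, one finite-dimensional model ODE); nothing here concerns the Navier–Stokes equations.
-/

-- the sub-problem namespace repeats the summit name by design (D-0017)
set_option linter.dupNamespace false

namespace Summit.NavierStokesRegularity.NavierStokesRegularity.Theorems.TaylorModelCert

open scoped BigOperators

namespace IntervalD

/-! ### Rounded range sums and convexity -/

/-- Rounded sum `Σ_{m<k} f m` (left to right, `roundOut prec` after each addition). [folklore] -/
def rangeSumR (prec : ℕ) (f : ℕ → IntervalD) : ℕ → IntervalD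
  | 0 => ofInt 0
  | k + 1 => addR prec (rangeSumR prec f k) (f k)

/-- `Σ_{m<k} g m ∈ rangeSumR prec f k` when `g m ∈ f m` for `m < k`. [folklore] -/
theorem mem_rangeSumR (prec : ℕ) {f : ℕ → IntervalD} {g : ℕ → ℝ} :
    ∀ k, (∀ m < k, mem (g m) (f m)) → mem (∑ m ∈ Finset.range k, g m) (rangeSumR prec f k)
  | 0, _ => by simpa [rangeSumR] using mem_ofInt 0
  | k + 1, h => by
    rw [Finset.sum_range_succ]
    exact mem_addR prec (mem_rangeSumR prec k fun m hm => h m (Nat.lt_succ_of_lt hm)) (h k (Nat.lt_succ_self k))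

/-- Intervals are convex: a real between two members is a member. [folklore] -/
theorem mem_of_le_of_le {a b x : ℝ} {I : IntervalD} (ha : mem a I) (hb : mem b I) (hax : a ≤ x) (hxb : x ≤ b) :
    mem x I :=
  ⟨ha.1.trans hax, hxb.trans hb.2⟩

/-- The point `0` lies in `ofInt 0`. [folklore] -/
theorem mem_zero : mem (0 : ℝ) (ofInt 0) := by simpa using mem_ofInt 0

/-! ### Interval extension of the jet recursion -/

section Jets

variable {V : Type*} {σ : Type*} (rd : V → σ → ℝ) (Q : V → V → V) {T : V → ℕ → V}

/-- `QB` is an INTERVAL EXTENSION of the field `Q` (read through the coordinates `rd`): coordinate boxes of the two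
arguments in, a box containing each coordinate of `Q u v` out. [folklore] -/
def IsFieldEnclosure (QB : (σ → IntervalD) → (σ → IntervalD) → σ → IntervalD) : Prop :=
  ∀ (U W : σ → IntervalD) (u w : V), (∀ c, mem (rd u c) (U c)) → (∀ c, mem (rd w c) (W c)) →
    ∀ c, mem (rd (Q u w) c) (QB U W c)

/-- The rounded interval evaluation of the recursion: level `k+1`, coordinate `c`, from the levels `0..k` of `J`:
`(Σ_{m≤k} QB (J m) (J (k-m)) c) / (k+1)`. [folklore] -/
def jetStep (QB : (σ → IntervalD) → (σ → IntervalD) → σ → IntervalD) (prec : ℕ) (J : ℕ → σ → IntervalD) (k : ℕ)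
    (c : σ) : IntervalD :=
  divNat prec (rangeSumR prec (fun m => QB (J m) (J (k - m)) c) (k + 1)) (k + 1)

/-- `J` is a JET ENCLOSURE up to order `K`: each level `k+1 ≤ K` CONTAINS the rounded interval evaluation of the recursion
from the lower levels (equality, `subset = true`, or any outward re-rounding all qualify). [folklore] -/
def IsJetEnclosure (QB : (σ → IntervalD) → (σ → IntervalD) → σ → IntervalD) (prec K : ℕ) (J : ℕ → σ → IntervalD) :
    Prop :=
  ∀ k < K, ∀ (c : σ) (x : ℝ), mem x (jetStep QB prec J k c) → mem x (J (k + 1) c)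

variable {rd Q}

/-- **The interval extension of the jet recursion encloses the jets** (fundamental theorem of interval arithmetic applied
to the Cauchy-product recursion): if `QB` is an interval extension of `Q`, `J` a jet enclosure up to order `K`, and every
coordinate of `y` lies in the level-`0` box, then `rd (T y k) c ∈ J k c` for all `k ≤ K`. [folklore; cite: Moore 1966 Ch. 3
(inclusion property); Nedialkov–Jackson–Corliss 1999 §3 (interval Taylor coefficients)] -/
theorem mem_jet_of_isJetEnclosure (hT0 : ∀ x c, rd (T x 0) c = rd x c)
    (hTs : ∀ x (k : ℕ) c, ((k : ℝ) + 1) * rd (T x (k + 1)) c =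
      ∑ i ∈ Finset.range (k + 1), rd (Q (T x i) (T x (k - i))) c)
    {QB : (σ → IntervalD) → (σ → IntervalD) → σ → IntervalD} (hQB : IsFieldEnclosure rd Q QB)
    {prec K : ℕ} {J : ℕ → σ → IntervalD} (hJ : IsJetEnclosure QB prec K J)
    {y : V} (hy : ∀ c, mem (rd y c) (J 0 c)) : ∀ k ≤ K, ∀ c, mem (rd (T y k) c) (J k c) := by
  intro k
  induction k using Nat.strong_induction_on with
  | _ k ih =>
    intro hk c
    cases k with
    | zero => rw [hT0]; exact hy c
    | succ k =>
      have hlev : ∀ m ≤ k, ∀ c, mem (rd (T y m) c) (J m c) := fun m hm c =>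
        ih m (Nat.lt_succ_of_le hm) (le_trans (Nat.le_succ_of_le hm) hk) c
      -- the recursion: `rd (T y (k+1)) c = (Σ_{m≤k} rd (Q (T y m) (T y (k-m))) c) / (k+1)`
      have hrec : rd (T y (k + 1)) c =
          (∑ i ∈ Finset.range (k + 1), rd (Q (T y i) (T y (k - i))) c) / ((k + 1 : ℕ) : ℝ) := by
        rw [eq_div_iff (by positivity), ← hTs y k c]; push_cast; ring
      rw [hrec]
      refine hJ k (Nat.lt_of_succ_le hk) c _ ?_
      refine mem_divNat prec (mem_rangeSumR prec (k + 1) fun m hm => ?_) (Nat.succ_pos k)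
      exact hQB (J m) (J (k - m)) (T y m) (T y (k - m)) (hlev m (Nat.le_of_lt_succ hm)) (hlev (k - m) (Nat.sub_le k m)) c

/-- The rounded interval evaluation of the VARIATIONAL recursion: level `k+1`, coordinate `c`, from the state levels `J` and the
variation levels `0..k` of `JU`: `(Σ_{m≤k} (QB (J m) (JU (k-m)) c + QB (JU (k-m)) (J m) c)) / (k+1)`. [folklore] -/
def varJetStep (QB : (σ → IntervalD) → (σ → IntervalD) → σ → IntervalD) (prec : ℕ) (J JU : ℕ → σ → IntervalD) (k : ℕ)
    (c : σ) : IntervalD :=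
  divNat prec (rangeSumR prec (fun m => addR prec (QB (J m) (JU (k - m)) c) (QB (JU (k - m)) (J m) c)) (k + 1)) (k + 1)

/-- `JU` is a VARIATIONAL JET ENCLOSURE up to order `K` along the state levels `J`: each level `k+1 ≤ K` contains the rounded
interval evaluation of the variational recursion. [folklore] -/
def IsVarJetEnclosure (QB : (σ → IntervalD) → (σ → IntervalD) → σ → IntervalD) (prec K : ℕ) (J JU : ℕ → σ → IntervalD) :
    Prop :=
  ∀ k < K, ∀ (c : σ) (x : ℝ), mem x (varJetStep QB prec J JU k c) → mem x (JU (k + 1) c)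

/-- **The interval extension of the variational recursion encloses the variational jets** `U y v k` (S1's `U_zero/U_succ`:
`rd (U x v 0) = rd v`, `(k+1)·rd (U x v (k+1)) c = Σ_{i≤k} (rd (Q (T x i) (U x v (k-i))) c + rd (Q (U x v (k-i)) (T x i)) c)`) for
every state `y` in the level-`0` state box and every direction `v` in the level-`0` variation box. [folklore] -/
theorem mem_varJet_of_isVarJetEnclosure {U : V → V → ℕ → V} (hT0 : ∀ x c, rd (T x 0) c = rd x c)
    (hTs : ∀ x (k : ℕ) c, ((k : ℝ) + 1) * rd (T x (k + 1)) c =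
      ∑ i ∈ Finset.range (k + 1), rd (Q (T x i) (T x (k - i))) c)
    (hU0 : ∀ x v c, rd (U x v 0) c = rd v c)
    (hUs : ∀ x v (k : ℕ) c, ((k : ℝ) + 1) * rd (U x v (k + 1)) c =
      ∑ i ∈ Finset.range (k + 1), (rd (Q (T x i) (U x v (k - i))) c + rd (Q (U x v (k - i)) (T x i)) c))
    {QB : (σ → IntervalD) → (σ → IntervalD) → σ → IntervalD} (hQB : IsFieldEnclosure rd Q QB)
    {prec K : ℕ} {J JU : ℕ → σ → IntervalD} (hJ : IsJetEnclosure QB prec K J) (hJU : IsVarJetEnclosure QB prec K J JU)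
    {y v : V} (hy : ∀ c, mem (rd y c) (J 0 c)) (hv : ∀ c, mem (rd v c) (JU 0 c)) :
    ∀ k ≤ K, ∀ c, mem (rd (U y v k) c) (JU k c) := by
  have hT := mem_jet_of_isJetEnclosure hT0 hTs hQB hJ hy
  intro k
  induction k using Nat.strong_induction_on with
  | _ k ih =>
    intro hk c
    cases k with
    | zero => rw [hU0]; exact hv c
    | succ k =>
      have hlev : ∀ m ≤ k, ∀ c, mem (rd (U y v m) c) (JU m c) := fun m hm c =>
        ih m (Nat.lt_succ_of_le hm) (le_trans (Nat.le_succ_of_le hm) hk) c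
      have hrec : rd (U y v (k + 1)) c = (∑ i ∈ Finset.range (k + 1),
          (rd (Q (T y i) (U y v (k - i))) c + rd (Q (U y v (k - i)) (T y i)) c)) / ((k + 1 : ℕ) : ℝ) := by
        rw [eq_div_iff (by positivity), ← hUs y v k c]; push_cast; ring
      rw [hrec]
      refine hJU k (Nat.lt_of_succ_le hk) c _ ?_
      refine mem_divNat prec (mem_rangeSumR prec (k + 1) fun m hm => ?_) (Nat.succ_pos k)
      have hTm := hT m (le_trans (Nat.le_of_lt_succ hm) ((Nat.le_succ k).trans hk))
      have hUm := hlev (k - m) (Nat.sub_le k m)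
      exact mem_addR prec (hQB (J m) (JU (k - m)) (T y m) (U y v (k - m)) hTm hUm c)
        (hQB (JU (k - m)) (J m) (U y v (k - m)) (T y m) hUm hTm c)

/-- **Box form, magnitude read-out** (the `hJ` of `TaylorModelVector.abs_sub_taylor_le_of_mem_Icc` at `V = ι → ℝ`): if the
corners `lo`, `hi` of a coordinate box lie in the level-`0` boxes of a jet enclosure, then for every `y ∈ [lo, hi]` and every
coordinate, `|T y (p+1) c| ≤ mag (J (p+1) c)`. [folklore] -/
theorem abs_jet_le_mag_of_mem_Icc {ι : Type*} {Q : (ι → ℝ) → (ι → ℝ) → ι → ℝ} {T : (ι → ℝ) → ℕ → ι → ℝ}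
    (hT0 : ∀ x, T x 0 = x)
    (hTs : ∀ x (k : ℕ) c, ((k : ℝ) + 1) * T x (k + 1) c = ∑ i ∈ Finset.range (k + 1), Q (T x i) (T x (k - i)) c)
    {QB : (ι → IntervalD) → (ι → IntervalD) → ι → IntervalD} (hQB : IsFieldEnclosure (fun (y : ι → ℝ) (c : ι) => y c) Q QB)
    {prec p : ℕ} {J : ℕ → ι → IntervalD} (hJ : IsJetEnclosure QB prec (p + 1) J)
    {lo hi : ι → ℝ} (hlo : ∀ c, mem (lo c) (J 0 c)) (hhi : ∀ c, mem (hi c) (J 0 c)) :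
    ∀ y ∈ Set.Icc lo hi, ∀ c, |T y (p + 1) c| ≤ (mag (J (p + 1) c)).toReal := by
  intro y hy c
  have hy0 : ∀ c, mem (y c) (J 0 c) := fun c => mem_of_le_of_le (hlo c) (hhi c) (hy.1 c) (hy.2 c)
  exact abs_le_mag (mem_jet_of_isJetEnclosure (rd := fun (y : ι → ℝ) (c : ι) => y c) (fun x c => by rw [hT0]) hTs hQB hJ
    hy0 (p + 1) le_rfl c)

/-- **Box form, interval read-out**: under the same hypotheses every jet coordinate of order `k ≤ K` of every point of the
box lies in `J k c` (sign information kept — used by the rough-enclosure test and the polynomial part). [folklore] -/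
theorem mem_jet_of_mem_Icc {ι : Type*} {Q : (ι → ℝ) → (ι → ℝ) → ι → ℝ} {T : (ι → ℝ) → ℕ → ι → ℝ}
    (hT0 : ∀ x, T x 0 = x)
    (hTs : ∀ x (k : ℕ) c, ((k : ℝ) + 1) * T x (k + 1) c = ∑ i ∈ Finset.range (k + 1), Q (T x i) (T x (k - i)) c)
    {QB : (ι → IntervalD) → (ι → IntervalD) → ι → IntervalD} (hQB : IsFieldEnclosure (fun (y : ι → ℝ) (c : ι) => y c) Q QB)
    {prec K : ℕ} {J : ℕ → ι → IntervalD} (hJ : IsJetEnclosure QB prec K J)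
    {lo hi : ι → ℝ} (hlo : ∀ c, mem (lo c) (J 0 c)) (hhi : ∀ c, mem (hi c) (J 0 c)) :
    ∀ y ∈ Set.Icc lo hi, ∀ k ≤ K, ∀ c, mem (T y k c) (J k c) := fun y hy =>
  mem_jet_of_isJetEnclosure (rd := fun (y : ι → ℝ) (c : ι) => y c) (fun x c => by rw [hT0]) hTs hQB hJ
    (fun c => mem_of_le_of_le (hlo c) (hhi c) (hy.1 c) (hy.2 c))

/-- A jet enclosure COMPUTED by the recursion (each level `k+1 ≤ K` literally `jetStep` of the lower levels) is a jet
enclosure. [folklore] -/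
theorem isJetEnclosure_of_eq {QB : (σ → IntervalD) → (σ → IntervalD) → σ → IntervalD} {prec K : ℕ}
    {J : ℕ → σ → IntervalD} (h : ∀ k < K, ∀ c, J (k + 1) c = jetStep QB prec J k c) : IsJetEnclosure QB prec K J :=
  fun k hk c x hx => by rw [h k hk c]; exact hx

/-- A jet enclosure CHECKED by the Boolean `subset` test (each level `k+1 ≤ K` a superset of `jetStep` of the lower levels,
e.g. emitted data re-verified) is a jet enclosure. [folklore] -/
theorem isJetEnclosure_of_subset {QB : (σ → IntervalD) → (σ → IntervalD) → σ → IntervalD} {prec K : ℕ}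
    {J : ℕ → σ → IntervalD} (h : ∀ k < K, ∀ c, subset (jetStep QB prec J k c) (J (k + 1) c) = true) :
    IsJetEnclosure QB prec K J :=
  fun k hk c _ hx => mem_of_subset (h k hk c) hx

end Jets

end IntervalD

end Summit.NavierStokesRegularity.NavierStokesRegularity.Theorems.TaylorModelCert
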